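import Literature.NumberTheory.Transcendental.KZLogCalculusProofs
import Literature.NumberTheory.Transcendental.KZTorusLogRep

/-!
# Band representations `[{x ∈ S, a x ≤ u ≤ b x}, g(x)/u]` and three moves on them

Helpers for route item ClausenPiVanishes (stmt-KontsevichZagierPeriods-5202) of route
KontsevichZagierPeriods/K2SymbolChains: existence of the honest KZ representation
`[{(x,u) | x ∈ S, a x ≤ u ≤ b x}, g(x)/u]` (value `∫_S g log (b/a)`), splitting it along the last
coordinate, discarding null differences, and the lift of a one-dimensional change of variables of
the base. Everything is an instance of Kontsevich–Zagier's rules 1)–2) [KZ 2001, §1.2] through the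
toolkit of `KZLogCalculusProofs.lean` (M. Kontsevich, D. Zagier, *Periods* (2001), §1.2; J. Bochnak,
M. Coste, M.-F. Roy, *Real Algebraic Geometry* (1998), §2.2 for the semialgebraic bookkeeping).
No new definitions: representations are produced by existence statements. [folklore]
-/

noncomputable section

open MeasureTheory Set Filter MvPolynomial
open Literature.ModelTheory.ExponentialFields (IsSemialgebraic tarski_seidenberg_real_holds
  isSemialgebraic_setOf_eval_lt isSemialgebraic_setOf_eval_le isSemialgebraic_setOf_eval_ne_zero
  isSemialgebraic_setOf_eval_eq_zero isSemialgebraic_univ)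
open Literature.NumberTheory.Transcendental
open Literature.NumberTheory.Transcendental.KZ

namespace Summit.KontsevichZagierPeriods.K2SymbolChains.ClausenPi

variable {m : ℕ}

/-- **Band representations exist.** For a `ℚ`-semialgebraic base `S ⊆ ℝᵐ`, `ℚ`-semialgebraic
`g` and edges `0 < a ≤ b` on `S` with `g · log (b/a)` absolutely integrable on `S`, the band
`{(x, u) | x ∈ S, a x ≤ u ≤ b x}` with the integrand `g(x)/u` is an honest KZ integral
representation (semialgebraicity by graph elimination; absolute integrability by Tonelli along
`u`, the fibre integral of `|g|/u` over `[a, b]` being `|g| log (b/a)`,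
`KZ.lintegral_enorm_div_Icc`). [Kontsevich–Zagier 2001, §1.1 (`log 2 = ∫₁² dx/x`)] [folklore] -/
theorem exists_bandRep {S : Set (Fin m → ℝ)} {a b g : (Fin m → ℝ) → ℝ}
    (hS : IsSemialgebraic ℚ S) (ha : IsSemialgebraicFunOn ℚ S a) (hb : IsSemialgebraicFunOn ℚ S b)
    (hg : IsSemialgebraicFunOn ℚ S g) (ha0 : ∀ x ∈ S, 0 < a x) (hab : ∀ x ∈ S, a x ≤ b x)
    (hint : IntegrableOn (fun x => g x * Real.log (b x / a x)) S) :
    ∃ R : KZ.IntegralRep (m + 1), R.domain = KZlog.band S a b ∧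
      R.integrand = fun z => g (Fin.init z) / z (Fin.last m) := by
  have hB : IsSemialgebraic ℚ (KZlog.band S a b) := KZlog.isSemialgebraic_band ha hb
  have hBm : MeasurableSet (KZlog.band S a b) := IsSemialgebraic.measurableSet_holds hB
  have hSm : MeasurableSet S := IsSemialgebraic.measurableSet_holds hS
  have hpos : ∀ z ∈ KZlog.band S a b, 0 < z (Fin.last m) := fun z hz =>
    (ha0 _ hz.1).trans_le hz.2.1
  have h1 : IsSemialgebraicFunOn ℚ (KZlog.band S a b) (fun z => g (Fin.init z)) :=
    hg.comp_init.mono (fun z hz => hz.1) hB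
  have h2 : IsSemialgebraicFunOn ℚ (KZlog.band S a b) (fun z => 1 / z (Fin.last m)) :=
    (isSemialgebraicFunOn_aeval_div_aeval hB 1 (MvPolynomial.X (Fin.last m)) fun z hz => by
      simpa using (hpos z hz).ne').congr fun z _ => by simp
  have hF : IsSemialgebraicFunOn ℚ (KZlog.band S a b)
      (fun z => g (Fin.init z) / z (Fin.last m)) :=
    (IsSemialgebraicFunOn.mul_holds h1 h2).congr fun z _ => by simp [div_eq_mul_inv]
  have hI : IntegrableOn (fun z => g (Fin.init z) / z (Fin.last m)) (KZlog.band S a b) := by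
    refine KZlog.integrableOn_band_of_lintegral_fibre_le hSm hBm (fun x t => KZlog.snoc_mem_band)
      (aestronglyMeasurable_of_isSemialgebraicFunOn hF hBm)
      (K := fun x => g x * Real.log (b x / a x)) (fun x hx => ?_) hint
    have : ∀ t, g (Fin.init (Fin.snoc x t : Fin (m + 1) → ℝ)) /
        (Fin.snoc x t : Fin (m + 1) → ℝ) (Fin.last m) = g x / t := fun t => by simp
    simp_rw [this]
    rw [lintegral_enorm_div_Icc (g x) (ha0 x hx) (hab x hx), Real.enorm_eq_ofReal_abs, abs_mul]
    exact ENNReal.ofReal_le_ofReal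
      (mul_le_mul_of_nonneg_left (le_abs_self _) (abs_nonneg _))
  exact ⟨⟨KZlog.band S a b, fun z => g (Fin.init z) / z (Fin.last m), hB, hF, hI⟩, rfl, rfl⟩

/-- **Discarding a null difference.** If `r.domain ⊆ R.domain`, the difference is Lebesgue-null
and the integrands agree on `r.domain`, then `[R] − [r]` is a relation (domain additivity, rule 1a),
with the restriction of `R` to the null difference, which is itself a relation). [Kontsevich–Zagier
2001, §1.2, rule 1)] [folklore] -/
theorem of_sub_of_mem_relations_of_subset_null {N : ℕ} (R r : KZ.IntegralRep N)
    (hsub : r.domain ⊆ R.domain) (hnull : volume (R.domain \ r.domain) = 0)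
    (hint : EqOn R.integrand r.integrand r.domain) : KZ.of R - KZ.of r ∈ KZ.relations := by
  have hD : IsSemialgebraic ℚ (R.domain \ r.domain) :=
    R.isSemialgebraic_domain.diff r.isSemialgebraic_domain
  set Rn := R.restrict _ hD Set.sdiff_subset with hRn
  have h1 : KZ.of R - KZ.of r - KZ.of Rn ∈ KZ.relations := by
    refine domainAddRel_subset_relations ⟨N, R, r, Rn, ?_, ?_, hint, fun _ _ => rfl, rfl⟩
    · rw [hRn, IntegralRep.domain_restrict, union_sdiff_cancel hsub]
    · rw [hRn, IntegralRep.domain_restrict, inter_sdiff_self, measure_empty]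
  have h2 : KZ.of Rn ∈ KZ.relations := of_mem_relations_of_volume_eq_zero _ hnull
  have : KZ.of R - KZ.of r = (KZ.of R - KZ.of r - KZ.of Rn) + KZ.of Rn := by abel
  rw [this]
  exact KZ.relations.add_mem h1 h2

/-- **Splitting a band along the last coordinate.** For a representation `R` on the band
`{x ∈ S, a x ≤ u ≤ b x}` and a `ℚ`-semialgebraic `c` with `a ≤ c ≤ b` on `S`, the restrictions to
the sub-bands `{a ≤ u ≤ c}` and `{c ≤ u ≤ b}` (meeting in the null graph of `c`) satisfy
`[R] − [R₁] − [R₂] ∈ relations` (rule 1a). [Kontsevich–Zagier 2001, §1.2, rule 1)] [folklore] -/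
theorem exists_split_last (R : KZ.IntegralRep (m + 1)) {S : Set (Fin m → ℝ)}
    {a b c : (Fin m → ℝ) → ℝ} (hR : R.domain = KZlog.band S a b) (hS : IsSemialgebraic ℚ S)
    (ha : IsSemialgebraicFunOn ℚ S a) (hb : IsSemialgebraicFunOn ℚ S b)
    (hc : IsSemialgebraicFunOn ℚ S c) (hac : ∀ x ∈ S, a x ≤ c x) (hcb : ∀ x ∈ S, c x ≤ b x) :
    ∃ R₁ R₂ : KZ.IntegralRep (m + 1), R₁.domain = KZlog.band S a c ∧ R₁.integrand = R.integrand ∧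
      R₂.domain = KZlog.band S c b ∧ R₂.integrand = R.integrand ∧
      KZ.of R - KZ.of R₁ - KZ.of R₂ ∈ KZ.relations := by
  have _ := hS
  have hb₁ : IsSemialgebraic ℚ (KZlog.band S a c) := KZlog.isSemialgebraic_band ha hc
  have hb₂ : IsSemialgebraic ℚ (KZlog.band S c b) := KZlog.isSemialgebraic_band hc hb
  have hs₁ : KZlog.band S a c ⊆ R.domain := fun z hz =>
    hR ▸ ⟨hz.1, hz.2.1, hz.2.2.trans (hcb _ hz.1)⟩
  have hs₂ : KZlog.band S c b ⊆ R.domain := fun z hz =>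
    hR ▸ ⟨hz.1, (hac _ hz.1).trans hz.2.1, hz.2.2⟩
  refine ⟨R.restrict _ hb₁ hs₁, R.restrict _ hb₂ hs₂, rfl, rfl, rfl, rfl, ?_⟩
  refine domainAddRel_subset_relations ⟨m + 1, R, R.restrict _ hb₁ hs₁, R.restrict _ hb₂ hs₂,
    ?_, ?_, fun _ _ => rfl, fun _ _ => rfl, rfl⟩
  · rw [IntegralRep.domain_restrict, IntegralRep.domain_restrict, hR]
    ext z
    simp only [KZlog.band, mem_setOf_eq, mem_union]
    constructor
    · rintro ⟨hx, h1, h2⟩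
      rcases le_total (z (Fin.last m)) (c (Fin.init z)) with h | h
      · exact Or.inl ⟨hx, h1, h⟩
      · exact Or.inr ⟨hx, h, h2⟩
    · rintro (⟨hx, h1, h2⟩ | ⟨hx, h1, h2⟩)
      · exact ⟨hx, h1, h2.trans (hcb _ hx)⟩
      · exact ⟨hx, (hac _ hx).trans h1, h2⟩
  · refine measure_mono_null (fun z hz => ?_) (volume_graph_eq_zero hc)
    rw [IntegralRep.domain_restrict, IntegralRep.domain_restrict] at hz
    exact ⟨hz.1.1, le_antisymm hz.1.2.2 hz.2.2.1⟩

/-- **A change of variable of the one-dimensional base lifts to band representations.** For a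
`ℚ`-semialgebraic `σ ⊆ ℝ¹`, a function `φ` with `t ↦ φ (t 0)` `ℚ`-semialgebraic on `σ`, differentiable
with derivative `φ'` at the points of `σ`, injective on `σ` with image `σ'`, and data `v = v' ∘ φ`,
`g = (g' ∘ φ) · |φ'|` on `σ`, the representations `[{x ∈ σ, 1 ≤ u ≤ v x}, g(x)/u]` and
`[{y ∈ σ', 1 ≤ u ≤ v' y}, g'(y)/u]` differ by ONE change-of-variables move (rule 2) along
`(x, u) ↦ (φ x, u)`, `KZ.of_sub_of_mem_relations_covLift`). [Kontsevich–Zagier 2001, §1.2,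
rule 2)] [folklore] -/
theorem of_sub_of_mem_relations_covLift_one {σ σ' : Set (Fin 1 → ℝ)} (hσ : IsSemialgebraic ℚ σ)
    {φ φ' : ℝ → ℝ} (hφ : IsSemialgebraicFunOn ℚ σ fun x => φ (x 0))
    (hder : ∀ x ∈ σ, HasDerivAt φ (φ' (x 0)) (x 0))
    (hinj : ∀ x ∈ σ, ∀ y ∈ σ, φ (x 0) = φ (y 0) → x 0 = y 0)
    (himage : (fun x : Fin 1 → ℝ => (fun _ : Fin 1 => φ (x 0))) '' σ = σ')
    {v v' g g' : (Fin 1 → ℝ) → ℝ} (hvv' : ∀ x ∈ σ, v x = v' (fun _ => φ (x 0)))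
    (hgg' : ∀ x ∈ σ, g x = g' (fun _ => φ (x 0)) * |φ' (x 0)|)
    (r r' : KZ.IntegralRep 2) (hr : r.domain = KZlog.band σ (fun _ => 1) v)
    (hri : r.integrand = fun z => g (Fin.init z) / z (Fin.last 1))
    (hr' : r'.domain = KZlog.band σ' (fun _ => 1) v')
    (hri' : r'.integrand = fun z => g' (Fin.init z) / z (Fin.last 1)) :
    KZ.of r - KZ.of r' ∈ KZ.relations := by
  set Φ : (Fin 1 → ℝ) → (Fin 1 → ℝ) := fun x _ => φ (x 0) with hΦ
  set Φ' : (Fin 1 → ℝ) → (Fin 1 → ℝ) →L[ℝ] (Fin 1 → ℝ) := fun x =>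
    φ' (x 0) • ContinuousLinearMap.id ℝ (Fin 1 → ℝ) with hΦ'
  have hdet : ∀ x, (Φ' x).det = φ' (x 0) := fun x => by
    simp [hΦ', ContinuousLinearMap.det, LinearMap.det_smul]
  have hΦd : ∀ x ∈ σ, HasFDerivWithinAt Φ (Φ' x) σ x := by
    intro x hx
    refine HasFDerivAt.hasFDerivWithinAt ?_
    rw [hasFDerivAt_pi']
    intro i
    have h1 : HasFDerivAt (fun y : Fin 1 → ℝ => φ (y 0))
        (φ' (x 0) • ContinuousLinearMap.proj (R := ℝ) (φ := fun _ : Fin 1 => ℝ) 0) x :=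
      (hder x hx).comp_hasFDerivAt x (hasFDerivAt_apply 0 x)
    refine h1.congr_fderiv (ContinuousLinearMap.ext fun w => ?_)
    simp [hΦ', Fin.fin_one_eq_zero i]
  have hΦs : IsSemialgebraicMapOn ℚ σ Φ := IsSemialgebraicMapOn.of_forall hσ fun _ => hφ
  have hΦi : InjOn Φ σ := by
    intro x hx y hy h
    have h0 : φ (x 0) = φ (y 0) := congrFun h 0
    funext i
    rw [Fin.fin_one_eq_zero i]
    exact hinj x hx y hy h0
  refine of_sub_of_mem_relations_covLift hΦs hΦd hΦi (v := v) (v' := v') hvv' r r' hr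
    (by rw [hr', ← himage]) fun z hz => ?_
  have hx : Fin.init z ∈ σ := by
    rw [hr] at hz
    exact hz.1
  rw [hri, hri', hdet]
  simp only [Fin.init_snoc, Fin.snoc_last]
  rw [hgg' _ hx]
  ring

end Summit.KontsevichZagierPeriods.K2SymbolChains.ClausenPi
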